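import Literature.RingTheory.HilbertSamuel.DirectrixLocal
import Literature.AlgebraicGeometry.Resolution.InitialFormsChangeOfParameters
import Mathlib.RingTheory.Nakayama
import HarnessLib

/-!
# The tangent cone ideal under a change of generators of `𝔪`; `e(𝒪)`, `ē(𝒪)` are well defined

Topic: `Literature/RingTheory/HilbertSamuel`. CJS, LNM 2270, Def. 2.18 defines the directrix of a
noetherian local ring `𝒪` INTRINSICALLY, inside `C(𝒪) = Spec gr_𝔫(𝒪) ⊆ T(𝒪) = Spec Sym(𝔫/𝔫²)`;
`DirectrixLocal.lean` computes it in a chosen minimal system of generators `x` of `𝔫`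
(`gr_𝔫(𝒪) = k[X_1, …, X_e]/J_x`, `J_x = tangentConeIdeal x hx`, `e(𝒪) = e(k[X]/J_x)`). Following
the pattern of `InitialFormsChangeOfParameters.lean` (Cossart–Piltant, regular case) we PROVE
that nothing depends on the choice:

* `exists_toForm_eq_of_isHomogeneous`, `mem_symbolForms_iff_exists_form` — `W_d(x)` consists of
  the reductions `F̄` of the forms `F` of degree `d` over `A` with `F(x) ∈ 𝔪ᵈ⁺¹`;
* `linSubst_image_symbolForms_subset`, `map_linSubst_tangentConeIdeal_le`,
  **`tangentConeIdeal_eq_map_linSubst`** — for two generating systems `x = a x'`, `x' = b x` of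
  the same length with `b̄ ā = 1`: **`J_{x'} = σ_ā(J_x)`** for the linear substitution
  `σ_ā : X_i ↦ Σ_j ā_{ij} X_j` (`linSubst`, `HironakaDirectrixLinear.lean`);
* `mem_maximalIdeal_of_sum_mul_mem_sq` — for a MINIMAL system of generators `x` of `𝔪`
  (`e = emb.dim`), a linear relation `Σ r_m x_m ∈ 𝔪²` has all `r_m ∈ 𝔪` (Nakayama); hence
  `map_residue_transition_mul_eq_one_of_minimal` — **`ā b̄ = 1`** for the transition matrices
  between two minimal systems of generators (the analogue of Matsumura 17.10 used in the regular
  case);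
* `linSubstEquiv` — `σ_ā` as a graded algebra automorphism when `ā` is invertible;
* **`directrixDim_tangentConeIdeal_eq_of_minimal`**, **`dirDim_eq`**, **`dirDimOver_eq`**,
  **`geomDirDim_eq`** — `e(𝒪)`, `e(𝒪)_K`, `ē(𝒪)` may be computed in ANY minimal system of
  generators of `𝔪` (`directrixDim_map_algEquiv`, `DirectrixDimension.lean`).

## References

* V. Cossart, U. Jannsen, S. Saito, *Desingularization: Invariants and Strategy*, LNM 2270
  (2020), Ch. 2, Def. 2.18, Def. 2.21. [CossartJannsenSaito2020]
* V. Cossart, O. Piltant, J. Algebra 320 (2008), proof of Prop. 4.2 (the regular case, as in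
  `InitialFormsChangeOfParameters.lean`). [CossartPiltant2008]
-/

noncomputable section

open IsLocalRing MvPolynomial Module
open Literature.AlgebraicGeometry.Resolution Literature.RingTheory.MvPolynomial

namespace Literature.RingTheory.HilbertSamuel

universe u v

/-! ## Forms of degree `d` and the spaces `W_d` -/

/-- A form of degree `d` is `toForm` of its coefficient vector on the monomials of degree `d`.
[folklore] -/
theorem exists_toForm_eq_of_isHomogeneous {R : Type u} [CommRing R] {e d : ℕ}
    {F : MvPolynomial (Fin e) R} (hF : F.IsHomogeneous d) :
    ∃ c : monomialsOfDegree e d →₀ R, toForm d c = F := by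
  refine ⟨Finsupp.subtypeDomain (fun m => Finsupp.degree m = d) (AddMonoidAlgebra.coeff F), ?_⟩
  have hsupp : ∀ m ∈ (AddMonoidAlgebra.coeff F).support, Finsupp.degree m = d := by
    intro m hm
    by_contra hne
    exact (MvPolynomial.mem_support_iff.mp hm) (hF.coeff_eq_zero hne)
  rw [toForm_apply, Finsupp.sum_subtypeDomain_index (v := AddMonoidAlgebra.coeff F)
    (h := fun m r => monomial m r) hsupp, MvPolynomial.sum_def]
  exact F.as_sum.symm

variable {A : Type u} [CommRing A] [IsLocalRing A] {e : ℕ}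

/-- **`W_d(x) = {F̄ : F a form of degree d over A with F(x) ∈ 𝔪ᵈ⁺¹}`.**
[cite: CossartJannsenSaito2020, §2.2 (p. 27)] -/
theorem mem_symbolForms_iff_exists_form (x : Fin e → A)
    (hx : Ideal.span (Set.range x) = maximalIdeal A) {d : ℕ}
    {f : MvPolynomial (Fin e) (ResidueField A)} :
    f ∈ symbolForms x hx d ↔ ∃ F : MvPolynomial (Fin e) A, F.IsHomogeneous d ∧
      eval x F ∈ maximalIdeal A ^ (d + 1) ∧ MvPolynomial.map (residue A) F = f := by
  constructor
  · rintro ⟨c, hc, rfl⟩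
    obtain ⟨c, rfl⟩ := coeffResidue_surjective d c
    refine ⟨toForm d c, isHomogeneous_toForm d c, ?_, map_residue_toForm d c⟩
    rw [← evalMonomials_eq_eval_toForm]
    exact (coeffResidue_mem_ker_symbolMap_iff x hx d c).mp hc
  · rintro ⟨F, hF, hFx, rfl⟩
    obtain ⟨c, rfl⟩ := exists_toForm_eq_of_isHomogeneous hF
    refine ⟨coeffResidue d c, ?_, (map_residue_toForm d c).symm⟩
    refine (coeffResidue_mem_ker_symbolMap_iff x hx d c).mpr ?_
    rwa [evalMonomials_eq_eval_toForm]

/-! ## Change of generators: `J_{x'} = σ_ā(J_x)` -/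

section Transition

variable {x x' : Fin e → A} (hx : Ideal.span (Set.range x) = maximalIdeal A)
  (hx' : Ideal.span (Set.range x') = maximalIdeal A)

/-- **`σ_ā(W_d(x)) ⊆ W_d(x')`** when `x_j = Σ_l a_{jl} x'_l`: if `F̄ ∈ W_d(x)` then `σ_ā F̄` is the
reduction of the form `σ_a F` with `(σ_a F)(x') = F(x) ∈ 𝔪ᵈ⁺¹`. [cite: CossartJannsenSaito2020, §2.2 (p. 27)] -/
theorem linSubst_image_symbolForms_subset {a : Matrix (Fin e) (Fin e) A}
    (ha : ∀ j, x j = ∑ l, a j l * x' l) (d : ℕ) :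
    linSubst (ResidueField A) (a.map (residue A)) '' (symbolForms x hx d : Set _) ⊆
      symbolForms x' hx' d := by
  rintro _ ⟨f, hf, rfl⟩
  obtain ⟨F, hF, hFx, rfl⟩ := (mem_symbolForms_iff_exists_form x hx).mp hf
  refine (mem_symbolForms_iff_exists_form x' hx').mpr ⟨linSubst A a F, isHomogeneous_linSubst a hF, ?_, ?_⟩
  · rw [eval_linSubst_of_transition ha]
    exact hFx
  · exact map_linSubst (residue A) a F

/-- Hence `σ_ā(J_x) ⊆ J_{x'}`. [cite: CossartJannsenSaito2020, §2.2 (p. 27)] -/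
theorem map_linSubst_tangentConeIdeal_le {a : Matrix (Fin e) (Fin e) A}
    (ha : ∀ j, x j = ∑ l, a j l * x' l) :
    (tangentConeIdeal x hx).map (linSubst (ResidueField A) (a.map (residue A))) ≤
      tangentConeIdeal x' hx' := by
  rw [tangentConeIdeal, Ideal.map_span, Ideal.span_le, Set.image_iUnion]
  intro f hf
  obtain ⟨d, hd⟩ := Set.mem_iUnion.mp hf
  exact mem_tangentConeIdeal_of_mem_symbolForms _ _ d (linSubst_image_symbolForms_subset hx hx' ha d hd)

/-- **`J_{x'} = σ_ā(J_x)`** for two generating systems of `𝔪` of the same length with transition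
matrices `x = a x'`, `x' = b x` whose reductions satisfy `b̄ ā = 1` (e.g. two minimal systems of
generators, `map_residue_transition_mul_eq_one_of_minimal`). [cite: CossartJannsenSaito2020, §2.2 (p. 27)] -/
theorem tangentConeIdeal_eq_map_linSubst {a b : Matrix (Fin e) (Fin e) A}
    (ha : ∀ j, x j = ∑ l, a j l * x' l) (hb : ∀ j, x' j = ∑ l, b j l * x l)
    (hba : b.map (residue A) * a.map (residue A) = 1) :
    tangentConeIdeal x' hx' =
      (tangentConeIdeal x hx).map (linSubst (ResidueField A) (a.map (residue A))) := by
  refine le_antisymm ?_ (map_linSubst_tangentConeIdeal_le hx hx' ha)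
  -- `J' = σ_ā(σ_b̄(J')) ⊆ σ_ā(J)`
  have hid : (linSubst (ResidueField A) (a.map (residue A))).comp
      (linSubst (ResidueField A) (b.map (residue A))) = AlgHom.id _ _ := by
    rw [← linSubst_mul, hba, linSubst_one]
  intro f hf
  have hf' : f = linSubst (ResidueField A) (a.map (residue A))
      (linSubst (ResidueField A) (b.map (residue A)) f) := by
    rw [← AlgHom.comp_apply, hid, AlgHom.id_apply]
  rw [hf']
  exact Ideal.mem_map_of_mem _ (map_linSubst_tangentConeIdeal_le hx' hx hb (Ideal.mem_map_of_mem _ hf))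

end Transition

/-! ## Minimal systems of generators -/

section Minimal

variable [IsNoetherianRing A]

/-- **A linear relation among minimal generators of `𝔪` has coefficients in `𝔪`**: if `x_1, …, x_e`
generate `𝔪` with `e = emb.dim A` and `Σ r_m x_m ∈ 𝔪²`, then every `r_m ∈ 𝔪` (otherwise `x_j` is
superfluous modulo `𝔪²`, and by Nakayama `𝔪` would be generated by `e - 1` elements). [folklore] -/
theorem mem_maximalIdeal_of_sum_mul_mem_sq {x : Fin e → A}
    (hx : Ideal.span (Set.range x) = maximalIdeal A) (he : (maximalIdeal A).spanFinrank = e)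
    {r : Fin e → A} (h : ∑ m, r m * x m ∈ maximalIdeal A ^ 2) (j : Fin e) :
    r j ∈ maximalIdeal A := by
  classical
  by_contra hrj
  have hu : IsUnit (r j) := (IsLocalRing.notMem_maximalIdeal.mp hrj)
  -- `𝔪 ⊆ (x_m : m ≠ j) + 𝔪²`
  set s : Finset (Fin e) := Finset.univ.erase j with hs
  set N : Ideal A := Ideal.span (x '' (s : Set (Fin e))) with hN
  have hxN : ∀ m, m ≠ j → x m ∈ N := fun m hm =>
    Ideal.subset_span ⟨m, by simp [hs, hm], rfl⟩
  have hxj : x j ∈ N ⊔ maximalIdeal A • maximalIdeal A := by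
    have hsplit : r j * x j = ∑ m, r m * x m - ∑ m ∈ s, r m * x m := by
      rw [hs, ← Finset.sum_erase_add _ _ (Finset.mem_univ j), add_sub_cancel_left]
    have hmem : r j * x j ∈ N ⊔ maximalIdeal A • maximalIdeal A := by
      rw [hsplit]
      refine sub_mem ?_ ?_
      · refine Submodule.mem_sup_right ?_
        rw [Ideal.smul_eq_mul, ← pow_two]
        exact h
      · exact Submodule.mem_sup_left (Ideal.sum_mem _ fun m hm =>
          Ideal.mul_mem_left _ _ (hxN m (Finset.ne_of_mem_erase hm)))
    have := Ideal.mul_mem_left _ (hu.unit⁻¹ : Aˣ).val hmem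
    rwa [← mul_assoc, IsUnit.val_inv_mul, one_mul] at this
  have hle : maximalIdeal A ≤ N ⊔ maximalIdeal A • maximalIdeal A := by
    refine hx.symm.le.trans (Ideal.span_le.mpr ?_)
    rintro _ ⟨m, rfl⟩
    by_cases hm : m = j
    · subst hm
      exact hxj
    · exact Submodule.mem_sup_left (hxN m hm)
  -- Nakayama: `𝔪 ⊆ N`, so `𝔪` is generated by `e - 1` elements
  have hmN : maximalIdeal A ≤ N :=
    Submodule.le_of_le_smul_of_le_jacobson_bot (IsNoetherian.noetherian _)
      (IsLocalRing.maximalIdeal_le_jacobson ⊥) hle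
  have hNm : N ≤ maximalIdeal A := by
    rw [hN, ← hx]
    exact Ideal.span_mono (Set.image_subset_range _ _)
  have heq : maximalIdeal A = N := le_antisymm hmN hNm
  have hrank : (maximalIdeal A).spanFinrank ≤ s.card := by
    rw [heq, hN]
    refine (Submodule.spanFinrank_span_le_ncard_of_finite (s.finite_toSet.image x)).trans ?_
    exact (Set.ncard_image_le s.finite_toSet).trans (by rw [Set.ncard_coe_finset])
  rw [he, hs, Finset.card_erase_of_mem (Finset.mem_univ j), Finset.card_univ, Fintype.card_fin] at hrank
  have hpos : 0 < e := Fin.pos j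
  omega

/-- **`ā b̄ = 1`** for the transition matrices between two minimal systems of generators of `𝔪`
(`x = a x'`, `x' = b x`): the linear form `Σ_m ((ab)_{jm} - δ_{jm}) X_m` vanishes at `x`, so its
coefficients lie in `𝔪`. [folklore] -/
theorem map_residue_transition_mul_eq_one_of_minimal {x x' : Fin e → A}
    (hx : Ideal.span (Set.range x) = maximalIdeal A) (he : (maximalIdeal A).spanFinrank = e)
    {a b : Matrix (Fin e) (Fin e) A}
    (ha : ∀ j, x j = ∑ l, a j l * x' l) (hb : ∀ j, x' j = ∑ l, b j l * x l) :
    a.map (residue A) * b.map (residue A) = 1 := by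
  rw [← Matrix.map_mul]
  ext j m
  have h1 : ∑ m', (a * b) j m' * x m' = x j := by
    simp only [Matrix.mul_apply, Finset.sum_mul]
    rw [Finset.sum_comm, ha j]
    refine Finset.sum_congr rfl fun l _ => ?_
    rw [hb l, Finset.mul_sum]
    exact Finset.sum_congr rfl fun m' _ => by ring
  have h2 : ∑ m', (1 : Matrix (Fin e) (Fin e) A) j m' * x m' = x j := by
    rw [Finset.sum_eq_single j, Matrix.one_apply_eq, one_mul]
    · intro m' _ hm'
      rw [Matrix.one_apply_ne (Ne.symm hm'), zero_mul]
    · exact fun h => (h (Finset.mem_univ j)).elim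
  have hsum : ∑ m', ((a * b) j m' - (1 : Matrix (Fin e) (Fin e) A) j m') * x m' ∈
      maximalIdeal A ^ 2 := by
    have : ∑ m', ((a * b) j m' - (1 : Matrix (Fin e) (Fin e) A) j m') * x m' = 0 := by
      simp only [sub_mul, Finset.sum_sub_distrib, h1, h2, sub_self]
    rw [this]
    exact zero_mem _
  have hcoeff := mem_maximalIdeal_of_sum_mul_mem_sq hx he hsum m
  rw [← residue_eq_zero_iff, map_sub, sub_eq_zero] at hcoeff
  rw [Matrix.map_apply, hcoeff, Matrix.one_apply, Matrix.one_apply]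
  split_ifs
  · exact map_one _
  · exact map_zero _

end Minimal

/-! ## `σ_ā` as a graded automorphism; invariance of `e` -/

section Equiv

variable {k : Type v} [Field k]

/-- **The linear substitution of an invertible matrix as an algebra automorphism**
(`σ_a ∘ σ_b = σ_{ba} = id`). [folklore] -/
def linSubstEquiv {a b : Matrix (Fin e) (Fin e) k} (hab : a * b = 1) (hba : b * a = 1) :
    MvPolynomial (Fin e) k ≃ₐ[k] MvPolynomial (Fin e) k :=
  AlgEquiv.ofAlgHom (linSubst k a) (linSubst k b)
    (by rw [← linSubst_mul, hba, linSubst_one])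
    (by rw [← linSubst_mul, hab, linSubst_one])

/-- `linSubstEquiv` is `linSubst`. [folklore] -/
theorem linSubstEquiv_apply {a b : Matrix (Fin e) (Fin e) k} (hab : a * b = 1) (hba : b * a = 1)
    (f : MvPolynomial (Fin e) k) : linSubstEquiv hab hba f = linSubst k a f :=
  rfl

/-- Ideals extend along `linSubstEquiv` as along `linSubst`. [folklore] -/
theorem map_linSubstEquiv {a b : Matrix (Fin e) (Fin e) k} (hab : a * b = 1) (hba : b * a = 1)
    (I : Ideal (MvPolynomial (Fin e) k)) :
    I.map (linSubstEquiv hab hba : MvPolynomial (Fin e) k →+* MvPolynomial (Fin e) k) =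
      I.map (linSubst k a) :=
  rfl

/-- **`e(S/σ_a I) = e(S/I)`** for an invertible linear substitution. [cite: CossartJannsenSaito2020, Rem. 2.9 (a)] -/
theorem directrixDim_map_linSubst {a b : Matrix (Fin e) (Fin e) k} (hab : a * b = 1) (hba : b * a = 1)
    (I : Ideal (MvPolynomial (Fin e) k)) :
    directrixDim (I.map (linSubst k a)) = directrixDim I := by
  rw [← map_linSubstEquiv hab hba]
  exact directrixDim_map_algEquiv (linSubstEquiv hab hba)
    (fun f hf => isHomogeneous_linSubst a hf) (fun f hf => isHomogeneous_linSubst b hf) I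

end Equiv

/-- Reduction / extension of coefficients commutes with the substitution: `σ_a F ↦ σ_{f(a)} f(F)`
(`map_linSubst` of `InitialFormsChangeOfParameters.lean`, with the target ring in an arbitrary
universe). [folklore] -/
theorem map_linSubst' {R : Type u} {S : Type v} [CommRing R] [CommRing S] (f : R →+* S)
    (a : Matrix (Fin e) (Fin e) R) (F : MvPolynomial (Fin e) R) :
    MvPolynomial.map f (linSubst R a F) = linSubst S (a.map f) (MvPolynomial.map f F) := by
  have : (MvPolynomial.map f).comp (linSubst R a).toRingHom =
      (linSubst S (a.map f)).toRingHom.comp (MvPolynomial.map f) := by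
    refine MvPolynomial.ringHom_ext (fun r => ?_) (fun j => ?_)
    · simp only [RingHom.comp_apply, AlgHom.toRingHom_eq_coe, AlgHom.coe_toRingHom,
        MvPolynomial.algHom_C, MvPolynomial.algebraMap_eq, map_C]
    · rw [RingHom.comp_apply, RingHom.comp_apply, AlgHom.toRingHom_eq_coe, AlgHom.coe_toRingHom,
        AlgHom.toRingHom_eq_coe, AlgHom.coe_toRingHom, linSubst_X, map_X, linSubst_X, map_sum]
      exact Finset.sum_congr rfl fun l _ => by rw [map_mul, map_C, map_X, Matrix.map_apply]
  exact RingHom.congr_fun this F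

/-! ## `e(𝒪)`, `e(𝒪)_K`, `ē(𝒪)` do not depend on the minimal system of generators -/

section Independence

variable [IsNoetherianRing A] {x x' : Fin e → A}
  (hx : Ideal.span (Set.range x) = maximalIdeal A) (hx' : Ideal.span (Set.range x') = maximalIdeal A)
  (he : (maximalIdeal A).spanFinrank = e)

include he in
/-- **`e(k[X]/J_{x'}) = e(k[X]/J_x)` for two minimal systems of generators of `𝔪`**, and likewise
after any extension `κ : k → K` of the residue field: `J_{x'} · K[X] = σ_{κ(ā)}(J_x · K[X])` with
`κ(ā)` invertible. [cite: CossartJannsenSaito2020, Def. 2.18] -/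
theorem directrixDim_map_tangentConeIdeal_eq_of_minimal {K : Type v} [Field K]
    (κ : ResidueField A →+* K) :
    directrixDim ((tangentConeIdeal x' hx').map (MvPolynomial.map κ)) =
      directrixDim ((tangentConeIdeal x hx).map (MvPolynomial.map κ)) := by
  obtain ⟨a, ha⟩ := exists_matrix_rsop_eq x x' (by rw [hx, hx'])
  obtain ⟨b, hb⟩ := exists_matrix_rsop_eq x' x (by rw [hx, hx'])
  have hab := map_residue_transition_mul_eq_one_of_minimal hx he ha hb
  have hba := map_residue_transition_mul_eq_one_of_minimal hx' he hb ha
  rw [tangentConeIdeal_eq_map_linSubst hx hx' ha hb hba,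
    show (tangentConeIdeal x hx).map (linSubst (ResidueField A) (a.map (residue A))) =
      (tangentConeIdeal x hx).map (linSubst (ResidueField A) (a.map (residue A)) :
        MvPolynomial (Fin e) (ResidueField A) →+* MvPolynomial (Fin e) (ResidueField A)) from rfl,
    Ideal.map_map]
  -- `map κ ∘ σ_ā = σ_{κ ā} ∘ map κ`
  have hcomm : (MvPolynomial.map κ).comp (linSubst (ResidueField A) (a.map (residue A)) :
      MvPolynomial (Fin e) (ResidueField A) →+* MvPolynomial (Fin e) (ResidueField A)) =
      (linSubst K ((a.map (residue A)).map κ) : MvPolynomial (Fin e) K →+* MvPolynomial (Fin e) K).comp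
        (MvPolynomial.map κ) :=
    RingHom.ext fun F => map_linSubst' κ (a.map (residue A)) F
  rw [hcomm, ← Ideal.map_map]
  have habK : (a.map (residue A)).map κ * (b.map (residue A)).map κ = 1 := by
    rw [← Matrix.map_mul, hab, Matrix.map_one _ (map_zero κ) (map_one κ)]
  have hbaK : (b.map (residue A)).map κ * (a.map (residue A)).map κ = 1 := by
    rw [← Matrix.map_mul, hba, Matrix.map_one _ (map_zero κ) (map_one κ)]
  exact directrixDim_map_linSubst habK hbaK _

include he in
/-- **`e(k[X]/J_{x'}) = e(k[X]/J_x)`** for two minimal systems of generators of `𝔪`.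
[cite: CossartJannsenSaito2020, Def. 2.18] -/
theorem directrixDim_tangentConeIdeal_eq_of_minimal :
    directrixDim (tangentConeIdeal x' hx') = directrixDim (tangentConeIdeal x hx) := by
  have h := directrixDim_map_tangentConeIdeal_eq_of_minimal hx hx' he (RingHom.id (ResidueField A))
  have hid : (MvPolynomial.map (RingHom.id (ResidueField A)) :
      MvPolynomial (Fin e) (ResidueField A) →+* MvPolynomial (Fin e) (ResidueField A)) = RingHom.id _ :=
    RingHom.ext fun p => MvPolynomial.map_id p
  rwa [hid, Ideal.map_id, Ideal.map_id] at h

end Independence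

section Canonical

variable (A) [IsNoetherianRing A]

/-- **`e(A)_K` computed in any minimal system of generators.** [cite: CossartJannsenSaito2020, Def. 2.18] -/
theorem dirDimOver_eq (K : Type v) [Field K] [Algebra (ResidueField A) K]
    (x : Fin (maximalIdeal A).spanFinrank → A) (hx : Ideal.span (Set.range x) = maximalIdeal A) :
    dirDimOver A K = directrixDim ((tangentConeIdeal x hx).map (MvPolynomial.map (algebraMap (ResidueField A) K))) :=
  directrixDim_map_tangentConeIdeal_eq_of_minimal hx (span_range_minGenerators A) rfl _

/-- **`e(A)` computed in any minimal system of generators** (CJS Def. 2.18 is intrinsic).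
[cite: CossartJannsenSaito2020, Def. 2.18] -/
theorem dirDim_eq (x : Fin (maximalIdeal A).spanFinrank → A)
    (hx : Ideal.span (Set.range x) = maximalIdeal A) :
    dirDim A = directrixDim (tangentConeIdeal x hx) :=
  directrixDim_tangentConeIdeal_eq_of_minimal hx (span_range_minGenerators A) rfl


/-- **`e(A)_K` computed in any minimal system of generators**, indexed by `Fin e` for any
`e = emb.dim A`. [cite: CossartJannsenSaito2020, Def. 2.18] -/
theorem dirDimOver_eq' (K : Type v) [Field K] [Algebra (ResidueField A) K] {e : ℕ}
    (he : (maximalIdeal A).spanFinrank = e) (x : Fin e → A)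
    (hx : Ideal.span (Set.range x) = maximalIdeal A) :
    dirDimOver A K = directrixDim ((tangentConeIdeal x hx).map (MvPolynomial.map (algebraMap (ResidueField A) K))) := by
  subst he
  exact dirDimOver_eq A K x hx

/-- **`e(A)` computed in any minimal system of generators**, indexed by `Fin e` for any
`e = emb.dim A`. [cite: CossartJannsenSaito2020, Def. 2.18] -/
theorem dirDim_eq' {e : ℕ} (he : (maximalIdeal A).spanFinrank = e) (x : Fin e → A)
    (hx : Ideal.span (Set.range x) = maximalIdeal A) :
    dirDim A = directrixDim (tangentConeIdeal x hx) := by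
  subst he
  exact dirDim_eq A x hx

/-- **`ē(A)` computed in any minimal system of generators.** [cite: CossartJannsenSaito2020, Def. 2.21] -/
theorem geomDirDim_eq (x : Fin (maximalIdeal A).spanFinrank → A)
    (hx : Ideal.span (Set.range x) = maximalIdeal A) :
    geomDirDim A = directrixDim ((tangentConeIdeal x hx).map
      (MvPolynomial.map (algebraMap (ResidueField A) (AlgebraicClosure (ResidueField A))))) :=
  dirDimOver_eq A _ x hx

end Canonical

end Literature.RingTheory.HilbertSamuel

end
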